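import Literature.MathematicalPhysics.QuantumFieldTheory.MassGapProofs
import HarnessLib

/-!
# Discharged fact: `UnitaryRep.hasMassGap_iff` (constructive-qft.S09, bridge of the two mass-gap encodings)

`Literature/MathematicalPhysics/QuantumFieldTheory/MassGap.lean` records the named fact
`Literature.Analysis.UnboundedOperators.UnitaryRep.hasMassGap_iff`: for a strongly continuous
one-parameter unitary group `U` on a complex Hilbert space, a vector `Ω` and `Δ : ℝ`, the
**bundled** mass gap `UnitaryRep.HasMassGap U Ω Δ` (`Ω` a vacuum vector of `U`; the Stone
Hamiltonian `H = U.hamiltonian` self-adjoint, `H ≥ 0`, `H Ω = 0`, `0 < Δ` and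
`Δ ‖ψ‖² ≤ ⟪ψ, H ψ⟫` on `D(H) ∩ {Ω}ᗮ`) is equivalent to the **unbundled** mass gap of wave 0,
`QuantumFieldTheory.HasMassGap U.appReal Ω Δ` (`Ω ≠ 0`, `0 < Δ`, and *some* self-adjoint
generator of the curve `t ↦ U(t)` in the sense of `QuantumFieldTheory.IsGenerator` annihilates
`Ω` and satisfies the gap inequality on `{Ω}ᗮ`). Both encode the definition of the mass gap of
Jaffe–Witten (2000), p. 6 and Streater–Wightman (1964), §3-1 (`H ≥ 0`, `H Ω = 0`, `0` a simple
eigenvalue, `σ(H) ∖ {0} ⊆ [Δ, ∞)`), so there is no printed proof to follow; the content of the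
bridge is Stone's theorem in the form of Reed–Simon I, Thm. VIII.7 (c)–(d).

This file proves it (`hasMassGap_iff_holds`):

* (`→`) take `H := U.hamiltonian`; it is a wave-0 generator of `U.appReal` by
  `UnitaryRep.isGenerator_appReal_hamiltonian_holds` (sibling file `MassGapProofs.lean`;
  Engel–Nagel (2000), §II.3.11), and the remaining fields are bookkeeping
  (`(ℂ ∙ Ω)ᗮ` versus `⟪Ω, ψ⟫ = 0`, `RCLike.re` versus `Complex.re`).
* (`←`) a wave-0 generator is *determined* by the curve — its domain is pinned to the vectors
  with convergent two-sided difference quotient and its value to `-i` times the (unique) limit —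
  so it equals `U.hamiltonian` (`eq_hamiltonian_of_isGenerator_appReal`; Reed–Simon I,
  Thm. VIII.7 (d), p. 265: "`B ⊃ A`, so `B = A`"). Then `H Ω = 0` forces `U(t) Ω = Ω`
  (`UnitaryRep.kernel_hamiltonian_le_invariantVectors`, Reed–Simon I, Thm. VIII.7 (c)), and
  `H ≥ 0` on all of `D(H)` follows from the gap on `D(H) ∩ {Ω}ᗮ`, `H Ω = 0` and the symmetry of
  `H` (`UnitaryRep.hamiltonian_isSymmetric`) by writing `x = ψ + c Ω` with `ψ ⊥ Ω`:
  `⟪x, H x⟫ = ⟪ψ, H ψ⟫ ≥ Δ ‖ψ‖² ≥ 0` — the remark in the wave-0 docstring that the gap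
  inequality on `{Ω}ᗮ` together with `H Ω = 0` already encodes `H ≥ 0`.

No new definitions and no new named facts.

## References

* A. Jaffe, E. Witten, *Quantum Yang–Mills theory*, Clay Mathematics Institute Millennium Problem
  description (2000), p. 6 (the mass gap `Δ > 0`). [JaffeWitten2000]
* M. Reed, B. Simon, *Methods of Modern Mathematical Physics I: Functional Analysis* (Academic
  Press, 1972/1980), §VIII.4, Thm. VIII.7 (c)–(d) and Thm. VIII.8 (Stone's theorem), pp. 265–267.
  [ReedSimonI1980]
* K.-J. Engel, R. Nagel, *One-Parameter Semigroups for Linear Evolution Equations* (Springer GTM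
  194, 2000), §II.3.11 (generators of groups). [EngelNagel2000]
* R. F. Streater, A. S. Wightman, *PCT, Spin and Statistics, and All That* (1964), §3-1 (vacuum,
  spectral condition). [StreaterWightman1964]
-/

noncomputable section

open Filter
open scoped InnerProductSpace Topology

namespace Literature.MathematicalPhysics.QuantumFieldTheory

section Bridge
open Literature.Analysis.UnboundedOperators (UnitaryRep)
open Literature.Analysis.UnboundedOperators.UnitaryRep

variable {H : Type*} [NormedAddCommGroup H] [InnerProductSpace ℂ H] [CompleteSpace H]

/-- A generator of the curve `t ↦ U(t)` in the sense of wave 0 (`QuantumFieldTheory.IsGenerator`: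
domain = the vectors with convergent two-sided difference quotient on `𝓝[≠] 0`, value = `-i`
times the limit) is uniquely determined by `U`: it is the Hamiltonian `U.hamiltonian`
(Reed–Simon I, Thm. VIII.7 (c)–(d), p. 265, "`B ⊃ A`, so `B = A`"; limits along `𝓝[≠] 0` are
unique, and `U.hamiltonian` is itself such a generator by
`isGenerator_appReal_hamiltonian_holds`). [cite: ReedSimonI1980, Thm. VIII.7 (d)] -/
theorem _root_.Literature.Analysis.UnboundedOperators.UnitaryRep.eq_hamiltonian_of_isGenerator_appReal
    (U : Literature.Analysis.UnboundedOperators.OneParameterUnitaryGroup H) {A : H →ₗ.[ℂ] H}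
    (hA : QuantumFieldTheory.IsGenerator U.appReal A) : A = U.hamiltonian := by
  have h₀ := isGenerator_appReal_hamiltonian_holds U
  refine LinearPMap.ext (Submodule.ext fun ψ => (hA.1 ψ).trans (h₀.1 ψ).symm) ?_
  intro ψ hψ hψ'
  have h := tendsto_nhds_unique (hA.2 ⟨ψ, hψ⟩) (h₀.2 ⟨ψ, hψ'⟩)
  exact smul_right_injective H Complex.I_ne_zero h

/-- **Discharge of `UnitaryRep.hasMassGap_iff` (constructive-qft.S09).** The bundled mass gap
`UnitaryRep.HasMassGap U Ω Δ` (vacuum vector `Ω` of `U`; self-adjoint Stone Hamiltonian `H ≥ 0`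
with `H Ω = 0`, `0 < Δ` and `Δ ‖ψ‖² ≤ ⟪ψ, H ψ⟫` on `D(H) ∩ {Ω}ᗮ`) and the unbundled mass gap
of wave 0, `QuantumFieldTheory.HasMassGap U.appReal Ω Δ` (some self-adjoint wave-0 generator of
`t ↦ U(t)` with the same properties), agree; both encode the mass gap of Jaffe–Witten (2000),
p. 6 / Streater–Wightman (1964), §3-1: `H ≥ 0`, `H Ω = 0`, `0` simple,
`σ(H) ∖ {0} ⊆ [Δ, ∞)`. (`→`) `H := U.hamiltonian` with `isGenerator_appReal_hamiltonian_holds`;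
(`←`) the wave-0 generator equals `U.hamiltonian` (`eq_hamiltonian_of_isGenerator_appReal`,
Reed–Simon I, Thm. VIII.7 (d)), `H Ω = 0` gives the invariance of `Ω`
(`kernel_hamiltonian_le_invariantVectors`, Reed–Simon I, Thm. VIII.7 (c)), and `H ≥ 0` on
`D(H)` follows from the gap on `{Ω}ᗮ`, `H Ω = 0` and the symmetry of `H` via `x = ψ + c Ω`,
`ψ ⊥ Ω`. [cite: JaffeWitten2000, p. 6] -/
theorem _root_.Literature.Analysis.UnboundedOperators.UnitaryRep.hasMassGap_iff_holds :
    hasMassGap_iff (H := H) := by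
  intro U Ω Δ
  constructor
  · rintro ⟨⟨-, hΩ0⟩, hsa, -, -, hker, hΔ, hbd⟩
    refine ⟨U.isUnitaryGroup_appReal, hΔ, hΩ0, U.hamiltonian, hsa,
      isGenerator_appReal_hamiltonian_holds U, hker, fun ψ hψ => ?_⟩
    have h := hbd ψ (Submodule.mem_orthogonal_singleton_iff_inner_right.mpr hψ)
    simpa only [RCLike.re_to_complex] using h
  · rintro ⟨-, hΔ, hΩ0, A, hsa, hgen, ⟨hΩ, hAΩ⟩, hbd⟩
    obtain rfl : A = U.hamiltonian := U.eq_hamiltonian_of_isGenerator_appReal hgen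
    have hinv : Ω ∈ U.invariantVectors :=
      U.kernel_hamiltonian_le_invariantVectors (LinearPMap.mem_kernel_iff.mpr ⟨hΩ, hAΩ⟩)
    -- the gap inequality in the prelude form
    have hbd' : U.hamiltonian.IsBoundedBelowOn (ℂ ∙ Ω)ᗮ Δ := fun ψ hψ => by
      have h := hbd ψ (Submodule.mem_orthogonal_singleton_iff_inner_right.mp hψ)
      simpa only [RCLike.re_to_complex] using h
    -- positivity of `H` on `D(H)`: split off the component along `Ω`
    have hpos : ∀ x : U.hamiltonian.domain, 0 ≤ RCLike.re ⟪(x : H), U.hamiltonian x⟫_ℂ := by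
      intro x
      have hΩΩ : ⟪Ω, Ω⟫_ℂ ≠ 0 := inner_self_ne_zero.mpr hΩ0
      have hΩx : ⟪Ω, U.hamiltonian x⟫_ℂ = 0 := by
        have hsym := U.hamiltonian_isSymmetric ⟨Ω, hΩ⟩ x
        rw [hAΩ, inner_zero_left] at hsym
        simpa only [Submodule.coe_mk] using hsym.symm
      -- `ψ := x - c Ω ∈ D(H)` with `c := ⟪Ω, x⟫ / ⟪Ω, Ω⟫` is orthogonal to `Ω` …
      have horth : ((x - (⟪Ω, (x : H)⟫_ℂ / ⟪Ω, Ω⟫_ℂ) • ⟨Ω, hΩ⟩ : U.hamiltonian.domain) : H) ∈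
          (ℂ ∙ Ω)ᗮ := by
        rw [Submodule.mem_orthogonal_singleton_iff_inner_right, Submodule.coe_sub,
          Submodule.coe_smul, Submodule.coe_mk, inner_sub_right, inner_smul_right,
          div_mul_cancel₀ _ hΩΩ, sub_self]
      -- … and has the same energy form as `x`, because `H Ω = 0` and `⟪Ω, H x⟫ = ⟪H Ω, x⟫ = 0`
      have hform : ∀ c : ℂ, ⟪((x - c • ⟨Ω, hΩ⟩ : U.hamiltonian.domain) : H),
          U.hamiltonian (x - c • ⟨Ω, hΩ⟩)⟫_ℂ = ⟪(x : H), U.hamiltonian x⟫_ℂ := by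
        intro c
        rw [LinearPMap.map_sub, LinearPMap.map_smul, hAΩ, smul_zero, sub_zero,
          Submodule.coe_sub, Submodule.coe_smul, Submodule.coe_mk, inner_sub_left,
          inner_smul_left, hΩx, mul_zero, sub_zero]
      have h := hbd' _ horth
      rw [hform] at h
      exact (mul_nonneg hΔ.le (sq_nonneg _)).trans h
    exact ⟨⟨hinv, hΩ0⟩, hsa, ⟨U.hamiltonian_isSymmetric, hpos⟩, hΩ0, ⟨hΩ, hAΩ⟩, hΔ, hbd'⟩

end Bridge

end Literature.MathematicalPhysics.QuantumFieldTheory
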